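import Mathlib
import Summits.QuantumAdvantage.Dequantization.KernelRidgeConditioning

/-!
# Mean-entry Rayleigh bound — DEQ-A154, Lemma A154-1(a) (receipt; fully proved)

HONEST FRAMING: instance-level adjudication of specific advantage claims; no claim about
BQP vs BPP or the summit.

Source: Hu–Li–Zhang–Jin, *A quantum gradient descent algorithm for optimizing Gaussian Process
models*, arXiv:2503.17780v1 = Math. Models Methods Appl. Sci. (2026), Assumption 1 (p. 7–8):
the normalised kernel matrix `K = K_f + σ_N² I` satisfies `‖K‖ ≤ 1`, so every Rayleigh quotient
of `K` is at most `1`.  DEQ-A154 (pub-qadeq-deq-1/DEQ-A154.md) Lemma A154-1(a): evaluating the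
Rayleigh quotient at the all-ones vector gives `N · k̄ + σ_N² ≤ 1`, where
`k̄ = N⁻² Σ_{ij} (K_f)_{ij}` is the mean Gram entry; hence `σ_N⁻² ≥ 1 + N k̄/σ_N²`, i.e. the
paper's `σ_N⁻²`-dependent costs grow at least linearly (Theorem 3: cubically) in the number of
data points whenever the mean prior covariance in units of the noise is bounded below.
This file proves the all-ones Rayleigh identity and the resulting entry-sum bounds for a real
matrix indexed by a `Fintype`; it is the lower-bound companion of
`KernelRidgeConditioning.dotProduct_mulVec_le_card_mul`.

Filed by the lead (harvest-1 gen 16) from deq-1's staging file with one change: the duplicate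
`dotProduct_regularised_mulVec` is imported from `KernelRidgeConditioning` instead of restated.
-/

namespace Summit.QuantumAdvantage.Dequantization.MeanEntryRayleigh

open Matrix Finset

variable {m : Type*} [Fintype m]

/-- The all-ones Rayleigh numerator is the entry sum: `1ᵀ K 1 = Σ_i Σ_j K_ij`. -/
theorem ones_dotProduct_mulVec_ones (K : Matrix m m ℝ) :
    (fun _ : m => (1 : ℝ)) ⬝ᵥ (K *ᵥ fun _ : m => (1 : ℝ)) = ∑ i, ∑ j, K i j := by
  simp [dotProduct, Matrix.mulVec]

/-- `1ᵀ 1 = card m`. -/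
theorem ones_dotProduct_ones :
    (fun _ : m => (1 : ℝ)) ⬝ᵥ (fun _ : m => (1 : ℝ)) = (Fintype.card m : ℝ) := by
  simp [dotProduct]

/-- Lemma A154-1(a), Rayleigh form: if every Rayleigh quotient of `K` is at most `Λ`
(for instance `Λ = λ_max(K)` for symmetric `K`, or `Λ = ‖K‖₂`), then the entry sum is at most
`Λ · card m`, i.e. `card m · k̄ ≤ Λ` for the mean entry `k̄`. -/
theorem sum_entries_le_of_rayleigh_le (K : Matrix m m ℝ) (Λ : ℝ)
    (h : ∀ v : m → ℝ, v ⬝ᵥ (K *ᵥ v) ≤ Λ * (v ⬝ᵥ v)) :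
    ∑ i, ∑ j, K i j ≤ Λ * (Fintype.card m : ℝ) := by
  have h1 := h (fun _ : m => (1 : ℝ))
  rwa [ones_dotProduct_mulVec_ones, ones_dotProduct_ones] at h1

/-- Lemma A154-1(a) for the paper's normalised kernel matrix `K = K_f + c•1` (`c = σ_N²`):
if every Rayleigh quotient of `K_f + c•1` is at most `Λ` (Assumption 1: `Λ = 1`), then
`Σ_ij (K_f)_ij + c · card m ≤ Λ · card m`; with `Λ = 1`, dividing by `card m · c` gives
`card m · k̄ / c + 1 ≤ 1 / c`, i.e. `σ_N⁻² ≥ 1 + N ρ` with `ρ = k̄ / σ_N²`. -/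
theorem sum_entries_add_le_of_regularised_rayleigh_le [DecidableEq m] (Kf : Matrix m m ℝ)
    (c Λ : ℝ) (h : ∀ v : m → ℝ, v ⬝ᵥ ((Kf + c • (1 : Matrix m m ℝ)) *ᵥ v) ≤ Λ * (v ⬝ᵥ v)) :
    ∑ i, ∑ j, Kf i j + c * (Fintype.card m : ℝ) ≤ Λ * (Fintype.card m : ℝ) := by
  have h1 := h (fun _ : m => (1 : ℝ))
  rwa [KernelRidgeConditioning.dotProduct_regularised_mulVec, ones_dotProduct_mulVec_ones,
    ones_dotProduct_ones] at h1

/-- The scale-free consequence used in DEQ-A154 (L.1): under Assumption 1 (`Λ = 1`) with noise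
`c > 0` and mean entry `kbar = (Σ_ij (K_f)_ij) / card²`, one has
`1 + card m · (kbar / c) ≤ 1 / c`. -/
theorem inv_noise_ge_one_add_card_mul_ratio [DecidableEq m] [Nonempty m] (Kf : Matrix m m ℝ)
    (c : ℝ) (hc : 0 < c)
    (h : ∀ v : m → ℝ, v ⬝ᵥ ((Kf + c • (1 : Matrix m m ℝ)) *ᵥ v) ≤ 1 * (v ⬝ᵥ v)) :
    1 + (Fintype.card m : ℝ) * (((∑ i, ∑ j, Kf i j) / (Fintype.card m : ℝ) ^ 2) / c) ≤ 1 / c := by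
  have hN : (0 : ℝ) < (Fintype.card m : ℝ) := by exact_mod_cast Fintype.card_pos
  have h1 := sum_entries_add_le_of_regularised_rayleigh_le Kf c 1 h
  rw [one_mul] at h1
  -- h1 : Σ + c·N ≤ N.  Goal: 1 + N·((Σ/N²)/c) ≤ 1/c, i.e. (c·N + Σ)/ (c·N) ≤ N/(c·N).
  have hcN : (0 : ℝ) < c * (Fintype.card m : ℝ) := mul_pos hc hN
  have key : 1 + (Fintype.card m : ℝ) * (((∑ i, ∑ j, Kf i j) / (Fintype.card m : ℝ) ^ 2) / c)
      = ((∑ i, ∑ j, Kf i j) + c * (Fintype.card m : ℝ)) / (c * (Fintype.card m : ℝ)) := by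
    field_simp
    ring
  rw [key, div_le_div_iff₀ hcN hc]
  nlinarith [h1, hc, hN]

end Summit.QuantumAdvantage.Dequantization.MeanEntryRayleigh
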